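import Summits.AtomisticToContinuum.BoseEinsteinCondensation.Theorems.BECConjugateDominationIMUChainGlueCorners
import Summits.AtomisticToContinuum.BoseEinsteinCondensation.Theorems.BECConjugateDominationIMUChainGlueBump
import Mathlib.Algebra.Order.Chebyshev
import HarnessLib

/-!
# Route `BECConjugateDomination`, glue `IMUChainGlue` (stmt-AtomisticToContinuum-11790) —
# helper: Parseval sums of the plane-wave integrals of the bump

For a continuous real `h` on `ℝ³` vanishing outside `‖x‖ < b`, `b ≤ L`, the corner sum
`F_h = ∑_{ε ∈ {0,1}³} h(· − Lε)` is a continuous function on `ℝ³` whose cell Fourier coefficients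
are `ĉₙ(F_h) = L⁻³ ∫_{ℝ³} conj(eₙ) h`, so Parseval on the cell gives
`∑ₙ |∫ conj(eₙ) h|² = L³ ∫_{[0,L)³} |F_h|² ≤ 8 L³ ∫_{ℝ³} h²`.  Applied to the scaled bump `η_a` and
its partial derivatives (with the integration-by-parts identity of the `Bump` file):
`∑ₙ |Eₙ|² ≤ 8L³ a⁻³ ∫χ²` and `∑ₙ |n|² |Eₙ|² ≤ (L/2π)² · 8L³ a⁻⁵ ∑ⱼ ∫|∂ⱼχ|²`, `Eₙ = ∫ conj(eₙ) η_a`.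
-/

noncomputable section

open MeasureTheory Set Complex
open scoped ENNReal NNReal Topology ComplexConjugate

namespace Summit.AtomisticToContinuum.BoseEinsteinCondensation.Theorems.IMUChainGlue

open Literature.MathematicalPhysics.QuantumManyBody.BoseGas

/-- The eight corners `{0,1}³ ⊂ ℤ³` (local notation, as in the `Corners` file). -/
local notation "corners" => (Fintype.piFinset fun _ : Fin 3 => ({0, 1} : Finset ℤ))

/-- The fixed profile (local notation, as in the `Bump` file). -/
local notation "χ" => (ContDiffBump.normed
  (ContDiffBump.mk 1 2 one_pos one_lt_two : ContDiffBump (0 : Space)) volume)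

/-- The scaled bump, value form (local notation, as in the `Bump` file). -/
local notation "ηv⟦" a ", " x "⟧" => (a ^ 3)⁻¹ * χ (a⁻¹ • x)

/-- The scaled bump, function form (local notation, as in the `Bump` file). -/
local notation "ηf⟦" a "⟧" => fun x : Space => (a ^ 3)⁻¹ * χ (a⁻¹ • x)

/-! ### Corner sums of a compactly supported function -/

section CornerSum

variable {L b : ℝ} {h : Space → ℝ}

/-- The corner sum `F_h = ∑_ε h(· − Lε)` (complex-valued) is continuous. -/
theorem continuous_cornerSum (L : ℝ) (hh : Continuous h) :
    Continuous fun x : Space => ∑ ε ∈ corners, (h (x - latticeVec L ε) : ℂ) :=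
  continuous_finsetSum _ fun _ _ => continuous_ofReal.comp (hh.comp (continuous_sub_right _))

/-- A continuous function vanishing outside a ball is integrable against a plane wave. -/
theorem integrable_conj_cellWave_mul (L : ℝ) (hh : Continuous h) (hh0 : ∀ x, b ≤ ‖x‖ → h x = 0)
    (n : Fin 3 → ℤ) : Integrable fun x => conj (cellWave L n x) * (h x : ℂ) := by
  refine ((continuous_cellWave L n).star.mul (continuous_ofReal.comp hh)).integrable_of_hasCompactSupport ?_
  refine HasCompactSupport.of_support_subset_isCompact (isCompact_closedBall (0 : Space) b) ?_
  intro x hx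
  rw [Metric.mem_closedBall, dist_zero_right]
  by_contra hlt
  refine hx ?_
  simp [hh0 x (not_le.1 hlt).le]

/-- **Fourier coefficients of a corner sum**: `ĉₙ(F_h) = L⁻³ ∫_{ℝ³} conj(eₙ) h`. -/
theorem cellFourierCoeff_cornerSum (hL : 0 < L) (hb : b ≤ L) (hh : Continuous h)
    (hh0 : ∀ x, b ≤ ‖x‖ → h x = 0) (n : Fin 3 → ℤ) :
    cellFourierCoeff L (fun x : Space => ∑ ε ∈ corners, (h (x - latticeVec L ε) : ℂ)) n =
      ((L ^ 3)⁻¹ : ℝ) • ∫ x, conj (cellWave L n x) * (h x : ℂ) := by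
  rw [cellFourierCoeff_eq_integral hL]
  congr 1
  have hG : ∀ x, b ≤ ‖x‖ → conj (cellWave L n x) * (h x : ℂ) = 0 := fun x hx => by
    rw [hh0 x hx, Complex.ofReal_zero, mul_zero]
  rw [← sum_corners_setIntegral_cell_sub hb hG (integrable_conj_cellWave_mul L hh hh0 n)]
  simp_rw [Finset.mul_sum]
  rw [integral_finsetSum]
  · refine Finset.sum_congr rfl fun ε _ => setIntegral_congr_fun (measurableSet_cell L) fun x _ => ?_
    rw [← cellWave_add_latticeVec hL.ne' n ε (x - latticeVec L ε), sub_add_cancel]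
  · intro ε _
    exact integrableOn_cell ((continuous_cellWave L n).star.mul
      (continuous_ofReal.comp (hh.comp (continuous_sub_right _))))

/-- **Parseval for a corner sum**: `∑ₙ |∫ conj(eₙ) h|² = L³ ∫_{[0,L)³} |F_h|²`. -/
theorem hasSum_norm_sq_integral_conj_cellWave_mul (hL : 0 < L) (hb : b ≤ L) (hh : Continuous h)
    (hh0 : ∀ x, b ≤ ‖x‖ → h x = 0) :
    HasSum (fun n : Fin 3 → ℤ => ‖∫ x, conj (cellWave L n x) * (h x : ℂ)‖ ^ 2)
      (L ^ 3 * ∫ x in cell L, ‖∑ ε ∈ corners, (h (x - latticeVec L ε) : ℂ)‖ ^ 2) := by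
  have hP := hasSum_sq_cellFourierCoeff hL (continuous_cornerSum L hh)
  simp only [cellFourierCoeff_cornerSum hL hb hh hh0, norm_smul, mul_pow, Real.norm_eq_abs,
    abs_inv, abs_of_pos (pow_pos hL 3)] at hP
  have hL3 : (L ^ 3) ≠ 0 := pow_ne_zero 3 hL.ne'
  set I := ∫ x in cell L, ‖∑ ε ∈ corners, (h (x - latticeVec L ε) : ℂ)‖ ^ 2 with hI
  have h2 := hP.mul_left ((L ^ 3) ^ 2)
  have hv : (L ^ 3) ^ 2 * ((L ^ 3)⁻¹ * I) = L ^ 3 * I := by field_simp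
  rw [hv] at h2
  refine h2.congr_fun fun n => ?_
  field_simp

/-- **The corner sum is at most eight translates**: `∫_{[0,L)³} |F_h|² ≤ 8 ∫_{ℝ³} h²`. -/
theorem setIntegral_norm_cornerSum_sq_le (hb : b ≤ L) (hh : Continuous h)
    (hh0 : ∀ x, b ≤ ‖x‖ → h x = 0) (hhi : Integrable fun x => h x ^ 2) :
    ∫ x in cell L, ‖∑ ε ∈ corners, (h (x - latticeVec L ε) : ℂ)‖ ^ 2 ≤ 8 * ∫ x, h x ^ 2 := by
  have hpt : ∀ x : Space, ‖∑ ε ∈ corners, (h (x - latticeVec L ε) : ℂ)‖ ^ 2 ≤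
      8 * ∑ ε ∈ corners, h (x - latticeVec L ε) ^ 2 := by
    intro x
    calc ‖∑ ε ∈ corners, (h (x - latticeVec L ε) : ℂ)‖ ^ 2
        ≤ (∑ ε ∈ corners, ‖(h (x - latticeVec L ε) : ℂ)‖) ^ 2 := by
          gcongr; exact norm_sum_le _ _
      _ = (∑ ε ∈ corners, |h (x - latticeVec L ε)|) ^ 2 := by
          simp only [Complex.norm_real, Real.norm_eq_abs]
      _ ≤ (Finset.card corners) * ∑ ε ∈ corners, |h (x - latticeVec L ε)| ^ 2 :=
          sq_sum_le_card_mul_sum_sq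
      _ = 8 * ∑ ε ∈ corners, h (x - latticeVec L ε) ^ 2 := by
          rw [card_corners]; simp [sq_abs]
  have h0 : ∀ x, b ≤ ‖x‖ → h x ^ 2 = 0 := fun x hx => by rw [hh0 x hx]; ring
  calc ∫ x in cell L, ‖∑ ε ∈ corners, (h (x - latticeVec L ε) : ℂ)‖ ^ 2
      ≤ ∫ x in cell L, 8 * ∑ ε ∈ corners, h (x - latticeVec L ε) ^ 2 := by
        refine setIntegral_mono_on ?_ ?_ (measurableSet_cell L) (fun x _ => hpt x)
        · exact integrableOn_cell ((continuous_cornerSum L hh).norm.pow 2)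
        · exact integrableOn_cell (continuous_const.mul (continuous_finsetSum _ fun ε _ =>
            (hh.comp (continuous_sub_right _)).pow 2))
    _ = 8 * ∑ ε ∈ corners, ∫ x in cell L, h (x - latticeVec L ε) ^ 2 := by
        rw [integral_const_mul, integral_finsetSum]
        intro ε _
        exact integrableOn_cell ((hh.comp (continuous_sub_right _)).pow 2)
    _ = 8 * ∫ x, h x ^ 2 := by
        rw [sum_corners_setIntegral_cell_sub (f := fun x => h x ^ 2) hb h0 hhi]

end CornerSum

/-! ### The two Parseval sums of the bump -/

/-- **`∑ₙ |Eₙ|² ≤ 8 L³ a⁻³ ∫χ²`** for the plane-wave integrals `Eₙ = ∫ conj(eₙ) η_a` of the scaled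
bump (`2a ≤ L`). -/
theorem exists_hasSum_norm_sq_bumpCoeff {L a : ℝ} (hL : 0 < L) (ha : 0 < a) (h2a : 2 * a ≤ L) :
    ∃ S₀ : ℝ, HasSum (fun n : Fin 3 → ℤ => ‖∫ x, conj (cellWave L n x) * ((ηv⟦a, x⟧ : ℝ) : ℂ)‖ ^ 2) S₀ ∧
      S₀ ≤ 8 * L ^ 3 * ((a ^ 3)⁻¹ * ∫ y : Space, (χ y) ^ 2) := by
  have h0 : ∀ x : Space, 2 * a ≤ ‖x‖ → ηv⟦a, x⟧ = 0 := fun x hx => bump_eq_zero ha hx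
  refine ⟨_, hasSum_norm_sq_integral_conj_cellWave_mul (h := ηf⟦a⟧) hL h2a (continuous_bump a) h0, ?_⟩
  have h := setIntegral_norm_cornerSum_sq_le (L := L) (h := ηf⟦a⟧) h2a (continuous_bump a) h0
    (integrable_bump_sq ha)
  rw [integral_bump_sq ha] at h
  have hL3 : 0 ≤ L ^ 3 := by positivity
  nlinarith

/-- Parseval sum of the plane-wave integrals of one partial derivative of the bump:
`∑ₙ |∫ conj(eₙ) ∂ⱼη_a|² ≤ 8 L³ a⁻⁵ ∫|∂ⱼχ|²` (`3a ≤ L`). -/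
theorem exists_hasSum_norm_sq_bumpDerivCoeff {L a : ℝ} (hL : 0 < L) (ha : 0 < a)
    (h3a : 3 * a ≤ L) (j : Fin 3) :
    ∃ T : ℝ, HasSum (fun n : Fin 3 → ℤ =>
        ‖∫ x, conj (cellWave L n x) * (fderiv ℝ ηf⟦a⟧ x (EuclideanSpace.single j 1) : ℂ)‖ ^ 2) T ∧
      T ≤ 8 * L ^ 3 * ((a ^ 5)⁻¹ * ∫ y : Space, (fderiv ℝ χ y (EuclideanSpace.single j 1)) ^ 2) := by
  have h0 : ∀ x : Space, 3 * a ≤ ‖x‖ → fderiv ℝ ηf⟦a⟧ x (EuclideanSpace.single j 1) = 0 :=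
    fun x hx => fderiv_bump_eq_zero ha hx _
  refine ⟨_, hasSum_norm_sq_integral_conj_cellWave_mul
    (h := fun x => fderiv ℝ ηf⟦a⟧ x (EuclideanSpace.single j 1)) hL h3a
    (continuous_fderiv_bump a _) h0, ?_⟩
  have h := setIntegral_norm_cornerSum_sq_le (L := L)
    (h := fun x => fderiv ℝ ηf⟦a⟧ x (EuclideanSpace.single j 1)) h3a (continuous_fderiv_bump a _)
    h0 (integrable_fderiv_bump_sq ha _)
  rw [integral_fderiv_bump_sq ha] at h
  have hL3 : 0 ≤ L ^ 3 := by positivity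
  nlinarith

/-- The squared Euclidean norm of `n ∈ ℤ³`: `‖latticeVec 1 n‖² = ∑ⱼ nⱼ²`. -/
theorem norm_latticeVec_one_sq (n : Fin 3 → ℤ) : ‖latticeVec 1 n‖ ^ 2 = ∑ j, (n j : ℝ) ^ 2 := by
  rw [EuclideanSpace.norm_sq_eq]
  refine Finset.sum_congr rfl fun j _ => ?_
  rw [latticeVec_apply, one_mul, Real.norm_eq_abs, sq_abs]

/-- **`∑ₙ |n|² |Eₙ|² ≤ (L/2π)² · 8 L³ a⁻⁵ ∑ⱼ ∫|∂ⱼχ|²`** (`|n|` the Euclidean norm of `n ∈ ℤ³`,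
i.e. `‖latticeVec 1 n‖`; integration by parts turns `(2π nⱼ/L) Eₙ` into the plane-wave integral
of `∂ⱼη_a`, to which the derivative bound applies), for `3a ≤ L`. -/
theorem exists_hasSum_norm_sq_mul_norm_sq_bumpCoeff {L a : ℝ} (hL : 0 < L) (ha : 0 < a)
    (h3a : 3 * a ≤ L) :
    ∃ S₁ : ℝ, HasSum (fun n : Fin 3 → ℤ =>
        ‖latticeVec 1 n‖ ^ 2 * ‖∫ x, conj (cellWave L n x) * ((ηv⟦a, x⟧ : ℝ) : ℂ)‖ ^ 2) S₁ ∧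
      S₁ ≤ (L / (2 * Real.pi)) ^ 2 * (8 * L ^ 3 * ((a ^ 5)⁻¹ *
        ∑ j : Fin 3, ∫ y : Space, (fderiv ℝ χ y (EuclideanSpace.single j 1)) ^ 2)) := by
  choose T hT hTle using fun j => exists_hasSum_norm_sq_bumpDerivCoeff hL ha h3a j
  set E : (Fin 3 → ℤ) → ℂ := fun n => ∫ x, conj (cellWave L n x) * ((ηv⟦a, x⟧ : ℝ) : ℂ) with hE
  -- `|∫ conj(eₙ) ∂ⱼη_a|² = (2π nⱼ/L)² |Eₙ|²`
  have hid : ∀ (n : Fin 3 → ℤ) (j : Fin 3),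
      ‖∫ x, conj (cellWave L n x) * (fderiv ℝ ηf⟦a⟧ x (EuclideanSpace.single j 1) : ℂ)‖ ^ 2 =
        (2 * Real.pi / L) ^ 2 * (n j : ℝ) ^ 2 * ‖E n‖ ^ 2 := by
    intro n j
    rw [integral_conj_cellWave_mul_fderiv_bump ha L n j, norm_mul]
    have hn : ‖(2 * Real.pi * Complex.I * (n j) / L : ℂ)‖ = 2 * Real.pi * |(n j : ℝ)| / L := by
      rw [show (2 * Real.pi * Complex.I * (n j) / L : ℂ) = ((2 * Real.pi * (n j : ℝ) / L : ℝ) : ℂ) * Complex.I by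
        push_cast; ring]
      rw [norm_mul, Complex.norm_I, mul_one, Complex.norm_real, Real.norm_eq_abs, abs_div, abs_mul,
        abs_of_pos (by positivity : (0 : ℝ) < 2 * Real.pi), abs_of_pos hL]
    rw [hn, mul_pow, div_pow, mul_pow, sq_abs]
    ring
  -- sum the three axes
  have hsum : HasSum (fun n : Fin 3 → ℤ => ∑ j : Fin 3,
      ‖∫ x, conj (cellWave L n x) * (fderiv ℝ ηf⟦a⟧ x (EuclideanSpace.single j 1) : ℂ)‖ ^ 2)
      (∑ j : Fin 3, T j) := hasSum_sum fun j _ => hT j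
  have hsum' : HasSum (fun n : Fin 3 → ℤ => (2 * Real.pi / L) ^ 2 * (‖latticeVec 1 n‖ ^ 2 * ‖E n‖ ^ 2))
      (∑ j : Fin 3, T j) := by
    refine hsum.congr_fun fun n => ?_
    simp only [hid]
    rw [norm_latticeVec_one_sq, Finset.sum_mul, Finset.mul_sum]
    refine Finset.sum_congr rfl fun j _ => ?_
    ring
  refine ⟨(L / (2 * Real.pi)) ^ 2 * ∑ j : Fin 3, T j, ?_, ?_⟩
  · refine (hsum'.mul_left ((L / (2 * Real.pi)) ^ 2)).congr_fun fun n => ?_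
    have hLpi : (L / (2 * Real.pi)) ^ 2 * (2 * Real.pi / L) ^ 2 = 1 := by
      field_simp
    rw [← mul_assoc, hLpi, one_mul]
  · refine mul_le_mul_of_nonneg_left ?_ (sq_nonneg _)
    calc ∑ j : Fin 3, T j
        ≤ ∑ j : Fin 3, 8 * L ^ 3 * ((a ^ 5)⁻¹ *
            ∫ y : Space, (fderiv ℝ χ y (EuclideanSpace.single j 1)) ^ 2) :=
          Finset.sum_le_sum fun j _ => hTle j
      _ = 8 * L ^ 3 * ((a ^ 5)⁻¹ *
            ∑ j : Fin 3, ∫ y : Space, (fderiv ℝ χ y (EuclideanSpace.single j 1)) ^ 2) := by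
          rw [Finset.mul_sum, Finset.mul_sum]

end Summit.AtomisticToContinuum.BoseEinsteinCondensation.Theorems.IMUChainGlue

end
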